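import Summits.Parity.GeneralizedHardyLittlewood.Theorems.LeeYangFibresCellParityLawDefs
import Literature.NumberTheory.Sieve.SieveFunctions
import Literature.NumberTheory.Sieve.SieveFramework
import HarnessLib

/-!
# Route `LeeYangFibres`, crux `CellParityLaw` (stmt-Parity-14109), line `section-annihilator`:
# sieve vocabulary for the `u = 2` rung of the analytic debt (skeleton v9)

Route-posited objects and statement types (D-0016 `<Route><Crux>…Defs` file; companion of
`LeeYangFibresCellParityLawDefs.lean`, kept separate to respect the 400-line limit). NOTHING IS ASSERTED:
every `def … : Prop` is the type of a registered stub of skeleton v9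
(`Cruxes/CellParityLaw/Lines/section_annihilator.lean`, continuation lead
`prover-line-stmt-Parity-14109-c1-0`), and the only theorems are bookkeeping in those statements.

## Why (lead c1, 2026-08-16)

The v8 analytic debt `stub_sectionPrLaw : ∀ t ≥ 1, SectionLevelAt t → SectionPrLawAt t` (Bombieri's
`P_r` law for the section sequences, every `u ≥ 2`) is split by the roughness parameter `u`:

* `u = 2` (`SectionPrLawAtU 2 t`) is KNOWN, UNIFORM, EFFECTIVE technology already in the tree: with
  `a_2 = 0` (a product of two primes `> N^{1/2}` exceeds `N`) the law at `u = 2` says exactly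
  (i) `C_{(1,j')} ≤ 2 · a_1 · H_{Ψ,i} · F⁽ⁱ⁾_{j'} + E` — the factor-`2` UPPER BOUND of the linear sieve
  (`F(2) = e^γ`: Iwaniec, *Rosser's sieve*, Acta Arith. 36 (1980) Thm 1, PROVED in the tree as
  `Iwaniec1980_thm1_upper_of_half_lt`, uniform over all sequences of dimension `Ω(1, L')`) fed with the
  atom's level of distribution, Mertens' product theorem with rate (`abs_prod_one_sub_inv_mul_log_sub_one_le`)
  and Alladi's `Ω`-cell asymptotic with rate (`exists_abs_roughCell_sub_main_le`) for `a_1`; and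
  (ii) the top cell `C_{(2,j')} ≤ E`, by the same sieve applied to the divisor sequences `b_p`,
  `N^{1/2} < p ≤ (3LN)^{1/2}`, whose remainders are again the atom's;
* `u ≥ 3` (`stub_prLawGeThree`) keeps the research-grade content (effective Bombieri completeness).

Objects: `sectionWeight` (the section sequence `b(m)` itself: lattice points of the fibre `ψ_i = m` with
the other forms frozen in their cells), `sectionDensityFn` (the section density as a multiplicative
arithmetic function, `0` at `0`), `sectionSeq … e` (the divisor sequence `q ↦ b(eq)` packaged as a tree
`SieveSequence` with density `g` and size `g(e) F⁽ⁱ⁾_{j'}`, so that its remainders ARE the atom's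
discrepancies at the moduli `ed`). Statement types: `SectionPrLawAtU`, `PrLawCasesStep` (bookkeeping,
proved: `stub_prLawCases`), `SectionSeqFacts`, `SectionDimension`, `SectionMertens`, `PrLawTwoPrep`, `PrLawTwoTopCell`,
`PrLawTwoMainCell`, `PrLawTwoAssembly`.

References: H. Iwaniec, Acta Arith. 36 (1980) 171–202, Thm 1 [IwaniecActaArith1980]; E. Bombieri, RIMS
Kôkyûroku 294 (1977) p. 5 [BombieriRIMS1977]; K. Alladi, Quart. J. Math. 33 (1982) Thm 1 [Alladi1982];
B. Green, T. Tao, Ann. of Math. 171 (2010) Def. 1.1, Lemma 1.3 [GreenTao2010].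
-/

noncomputable section

open scoped BigOperators Classical
open Finset Literature.NumberTheory.Sieve

namespace Summit.Parity.GeneralizedHardyLittlewood.Cruxes.CellParityLaw.SectionAnnihilator

/-! ## The `P_r` law at a fixed roughness parameter, and the case split -/

/-- **Bombieri's `P_r` law for the sections at a FIXED `u`** (`SectionPrLawAtU u t`): the body of
`SectionPrLawAt t` with the roughness parameter `u` fixed instead of universally quantified
(`SectionPrLawAt t ↔ ∀ u ≥ 2, SectionPrLawAtU u t`, `sectionPrLawAt_iff_forall`). Type of the stubs
`stub_prLawGeThree` (`u ≥ 3`, the research-grade remainder of the debt) and, at `u = 2`, conclusion of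
`stub_prLawTwoAssembly` (the linear-sieve rung). -/
def SectionPrLawAtU (u t : ℕ) : Prop :=
  ∀ (L B : ℕ), ∃ N₀ : ℕ, ∀ N : ℕ, N₀ ≤ N →
    ∀ Ψ : Fin (t + 1) → AffLinForm 1, IsNondegenerateSystem Ψ → affLinSize Ψ N ≤ L →
    ∀ K : Set (Fin 1 → ℝ), Convex ℝ K → K ⊆ realBox 1 N →
    ∀ i : Fin (t + 1), ∀ j' : Fin t → ℕ, (∀ k, 1 ≤ j' k ∧ j' k ≤ u) →
      ∃ δ : ℝ, 0 ≤ δ ∧ δ ≤ 2 ∧ ∀ m : ℕ, 1 ≤ m → m ≤ u →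
        |(cell Ψ K N u (i.insertNth m j') : ℝ) -
            (1 + (δ - 1) * (-1 : ℝ) ^ m) * modelDensity N u m * sectionH Ψ i *
                (sectionMass Ψ K N u i j' 1 : ℝ)|
          ≤ (N : ℝ) / (Real.log N ^ (t + 1) * Real.log (Real.log N) ^ B)

/-- `SectionPrLawAt t` is the conjunction of its fixed-`u` instances (quantifier shuffle). -/
theorem sectionPrLawAt_iff_forall (t : ℕ) :
    SectionPrLawAt t ↔ ∀ u : ℕ, 2 ≤ u → SectionPrLawAtU u t :=
  ⟨fun h u hu L B => h L u B hu, fun h L u B hu => h u hu L B⟩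

/-- **The case split of the debt** (`PrLawCasesStep`; type of the bookkeeping stub `stub_prLawCases`):
the `u = 2` rung and the `u ≥ 3` remainder give the v8 debt `∀ t ≥ 1, SectionLevelAt t → SectionPrLawAt t`. -/
def PrLawCasesStep : Prop :=
  (∀ t : ℕ, 1 ≤ t → SectionLevelAt t → SectionPrLawAtU 2 t) →
    (∀ t : ℕ, 1 ≤ t → SectionLevelAt t → ∀ u : ℕ, 3 ≤ u → SectionPrLawAtU u t) →
      ∀ t : ℕ, 1 ≤ t → SectionLevelAt t → SectionPrLawAt t

/-- **`stub_prLawCases`** (registered bookkeeping stub of skeleton v9; pure logic): `u = 2` or `u ≥ 3`. -/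
theorem stub_prLawCases : PrLawCasesStep := by
  intro h2 h3 t ht hA
  rw [sectionPrLawAt_iff_forall]
  intro u hu
  rcases Nat.lt_or_ge u 3 with hlt | hge
  · obtain rfl : u = 2 := by omega
    exact h2 t ht hA
  · exact h3 t ht hA u hge

/-! ## The section sequence and its divisor sequences as sifted sequences -/

/-- **The section sequence** `b(m) = #{n ∈ [-N,N] ∩ K : ψ_i(n) = m, ψ_{i.succAbove k}(n) ∈ cell j'_k ∀ k}`:
the number of lattice points in the fibre `ψ_i = m` whose other forms sit in their frozen rough `Ω`-cells
(so `b(m) ∈ {0, 1}` when `a_i ≠ 0`). Its mass over the multiples of `d ≥ 1` is `sectionMass … d`. -/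
def sectionWeight {t : ℕ} (Ψ : Fin (t + 1) → AffLinForm 1) (K : Set (Fin 1 → ℝ)) (N u : ℕ)
    (i : Fin (t + 1)) (j' : Fin t → ℕ) (m : ℕ) : ℕ :=
  ((latticeBox 1 N).filter (fun n => realPoint n ∈ K ∧ (Ψ i).eval n = (m : ℤ) ∧
      ∀ k : Fin t, (N : ℝ) ^ ((1 : ℝ) / u) < (Nat.minFac ((Ψ (i.succAbove k)).eval n).toNat : ℝ) ∧
        ArithmeticFunction.cardFactors ((Ψ (i.succAbove k)).eval n).toNat = j' k)).card

/-- **The section density as an arithmetic function** (`0` at `0`, `sectionDensity Ψ i d` at `d ≥ 1`);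
multiplicative (`isMultiplicative_sectionDensityFn`), as the tree's `SieveSequence` requires. -/
def sectionDensityFn {t : ℕ} (Ψ : Fin (t + 1) → AffLinForm 1) (i : Fin (t + 1)) :
    ArithmeticFunction ℝ where
  toFun d := if d = 0 then 0 else sectionDensity Ψ i d
  map_zero' := if_pos rfl

/-- `sectionDensityFn` at `d ≠ 0` is `sectionDensity`. -/
theorem sectionDensityFn_apply {t : ℕ} (Ψ : Fin (t + 1) → AffLinForm 1) (i : Fin (t + 1)) {d : ℕ}
    (hd : d ≠ 0) : sectionDensityFn Ψ i d = sectionDensity Ψ i d := by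
  change (if d = 0 then 0 else sectionDensity Ψ i d) = _
  rw [if_neg hd]

/-- The section density is multiplicative: it is a product over the prime factors, and the prime
factors of a product of coprime numbers are the disjoint union of theirs. -/
theorem isMultiplicative_sectionDensityFn {t : ℕ} (Ψ : Fin (t + 1) → AffLinForm 1) (i : Fin (t + 1)) :
    (sectionDensityFn Ψ i).IsMultiplicative := by
  refine ⟨?_, ?_⟩
  · rw [sectionDensityFn_apply Ψ i one_ne_zero, sectionDensity, Nat.primeFactors_one,
      Finset.prod_empty]
  · intro m n hmn
    rcases Nat.eq_zero_or_pos m with rfl | hm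
    · simp only [zero_mul, ArithmeticFunction.map_zero]
    rcases Nat.eq_zero_or_pos n with rfl | hn
    · simp only [mul_zero, ArithmeticFunction.map_zero]
    rw [sectionDensityFn_apply Ψ i (Nat.pos_iff_ne_zero.mp (Nat.mul_pos hm hn)),
      sectionDensityFn_apply Ψ i (Nat.pos_iff_ne_zero.mp hm),
      sectionDensityFn_apply Ψ i (Nat.pos_iff_ne_zero.mp hn), sectionDensity, sectionDensity,
      sectionDensity, Nat.Coprime.primeFactors_mul hmn,
      Finset.prod_union hmn.disjoint_primeFactors]

/-- **The divisor sequences of the section sequence, as sifted sequences** (`sectionSeq … e`, `e ≥ 1`;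
`e = 1` is `b` itself): weights `q ↦ b(eq)`, density the section density `g`, and the CONSTANT size
function `X = g(e) · F⁽ⁱ⁾_{j'}` (`F⁽ⁱ⁾_{j'} = sectionMass … 1`), so that for `d` coprime to `e` the
remainder `R_d(x) = A_d(x) − g(d) X` is the atom's discrepancy `sectionMass … (ed) − g(ed) F⁽ⁱ⁾_{j'}` as
soon as `x` exceeds all values of `ψ_i/e` (`SectionSeqFacts`). -/
def sectionSeq {t : ℕ} (Ψ : Fin (t + 1) → AffLinForm 1) (K : Set (Fin 1 → ℝ)) (N u : ℕ)
    (i : Fin (t + 1)) (j' : Fin t → ℕ) (e : ℕ) : SieveSequence where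
  a q := (sectionWeight Ψ K N u i j' (e * q) : ℝ)
  a_nonneg _ := Nat.cast_nonneg _
  size _ := sectionDensity Ψ i e * (sectionMass Ψ K N u i j' 1 : ℝ)
  density := sectionDensityFn Ψ i
  density_mult := isMultiplicative_sectionDensityFn Ψ i

/-! ## Statement types of the `u = 2` rung (registered stubs of skeleton v9) -/

/-- **Bookkeeping identities of the section sequences** (`SectionSeqFacts`; type of `stub_sectionSeqFacts`),
for every system, body, scale, coordinate and frozen cells:
(a) once `e·x` bounds every value of `ψ_i` on the box, the congruence sums of `sectionSeq … e` are the
section masses at the moduli `e·d`; (b) hence, for `d ≠ 0` coprime to `e`, its remainders are the atom's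
discrepancies at `e·d`; (c) the prime cell `C_{(1,j')}` is at most the sifted mass `S(b, z)` for
`2 ≤ z ≤ N^{1/u}`; (d) at `u = 2` the top cell `C_{(2,j')}` (values `p₁p₂`, `N^{1/2} < p₁ ≤ p₂`) is at most
the total sifted mass `∑_{N^{1/2} < p ≤ M} S(b_p, z)` of the divisor sequences, for `2 ≤ z ≤ N^{1/2}`, once
`M²` bounds every value of `ψ_i`. Elementary counting. -/
def SectionSeqFacts : Prop :=
  ∀ (t : ℕ) (Ψ : Fin (t + 1) → AffLinForm 1) (K : Set (Fin 1 → ℝ)) (N u : ℕ) (i : Fin (t + 1))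
    (j' : Fin t → ℕ),
    (∀ (e : ℕ) (x : ℝ), 1 ≤ e → (∀ n ∈ latticeBox 1 N, (((Ψ i).eval n : ℤ) : ℝ) ≤ e * x) →
        ∀ d : ℕ, (sectionSeq Ψ K N u i j' e).congrSum d x = sectionMass Ψ K N u i j' (e * d)) ∧
    (∀ (e : ℕ) (x : ℝ), 1 ≤ e → (∀ n ∈ latticeBox 1 N, (((Ψ i).eval n : ℤ) : ℝ) ≤ e * x) →
        ∀ d : ℕ, d ≠ 0 → Nat.Coprime e d →
          (sectionSeq Ψ K N u i j' e).remainder d x =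
            (sectionMass Ψ K N u i j' (e * d) : ℝ) -
              sectionDensity Ψ i (e * d) * (sectionMass Ψ K N u i j' 1 : ℝ)) ∧
    (∀ (x z : ℝ), 1 ≤ u → (∀ n ∈ latticeBox 1 N, (((Ψ i).eval n : ℤ) : ℝ) ≤ x) → 2 ≤ z →
        z ≤ (N : ℝ) ^ ((1 : ℝ) / u) →
          (cell Ψ K N u (i.insertNth 1 j') : ℝ) ≤
            (sectionSeq Ψ K N u i j' 1).sifted x (primesProdBelow z)) ∧
    (∀ (x z : ℝ) (M : ℕ), u = 2 → (∀ n ∈ latticeBox 1 N, (((Ψ i).eval n : ℤ) : ℝ) ≤ x) →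
        (∀ n ∈ latticeBox 1 N, (Ψ i).eval n ≤ (M : ℤ) ^ 2) → 2 ≤ z → z ≤ (N : ℝ) ^ ((1 : ℝ) / 2) →
          (cell Ψ K N 2 (i.insertNth 2 j') : ℝ) ≤
            ∑ p ∈ (Finset.Icc 1 M).filter (fun p : ℕ => p.Prime ∧ (N : ℝ) ^ ((1 : ℝ) / 2) < (p : ℝ)),
              (sectionSeq Ψ K N 2 i j' p).sifted x (primesProdBelow z))

/-- **Dimension `Ω(1, L')` of the section densities, uniformly** (`SectionDimension`; type of
`stub_sectionDimension`): for every number of frozen forms `t` there is ONE `L'` such that every section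
density with no degenerate prime (`g(p) < 1` for all `p`) satisfies Iwaniec's `Ω(1, L')`. (Each form has
`0`, `1` or `p` zeros mod `p`; hence `g(p) ≤ 1/2` always and `g(p) ≤ 1/(p - t)` for `p > t`, a majorant
whose Mertens products are controlled with rate; holes `g(p) = 0` only help.) -/
def SectionDimension : Prop :=
  ∀ t : ℕ, ∃ L' : ℝ, ∀ (Ψ : Fin (t + 1) → AffLinForm 1) (i : Fin (t + 1)),
    (∀ p : ℕ, p.Prime → sectionDensity Ψ i p < 1) → HasIwaniecDimension (sectionDensityFn Ψ i) 1 L'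

/-- **Mertens-side main-term control** (`SectionMertens`; type of `stub_sectionMertens`): for
non-degenerate systems of size `≤ L`, coordinates `i` with no degenerate prime and no local obstruction of
`Ψ₋ᵢ` (so `H_{Ψ,i} = 𝔖(Ψ)/𝔖(Ψ₋ᵢ) > 0`), `B_η ≥ 1` and `N ≥ N₀(t, L, B_η)`:
(sharp) with `η = (log log N)^{-B_η}` (`< 1` for `log log N > 1`) and `z = N^{(1-η)/2}`,
`e^γ · ∏_{p < z} (1 - g(p)) ≤ (2/((1-η) log N)) · H_{Ψ,i} · (1 + C/log N)` (Mertens with rate for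
`∏_{p<z}(1 - 1/p)`, and the tail `∏_{p ≥ z} (1-g(p))/(1-1/p) ≥ 1 - 4t/z` of Bombieri's constant);
(crude) `∏_{p < z} (1 - g(p)) ≤ C (log log N)/log z` for all `2 ≤ z ≤ N` (holes divide
`Δ = |a_i| ∏ |a_i b_k - a_k b_i| ≤ L (2L²N)^t`, `Δ/φ(Δ) ≪ log log N`). -/
def SectionMertens : Prop :=
  ∀ (t L Bη : ℕ), 1 ≤ Bη → ∃ C : ℝ, ∃ N₀ : ℕ, ∀ N : ℕ, N₀ ≤ N →
    ∀ Ψ : Fin (t + 1) → AffLinForm 1, IsNondegenerateSystem Ψ → affLinSize Ψ N ≤ L →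
    ∀ i : Fin (t + 1), (∀ p : ℕ, p.Prime → sectionDensity Ψ i p < 1) →
      singularProduct (Fin.removeNth i Ψ) ≠ 0 →
      (Real.exp Real.eulerMascheroniConstant *
          ∏ p ∈ Nat.primesBelow
              ⌈(N : ℝ) ^ ((1 - 1 / Real.log (Real.log N) ^ Bη) / 2)⌉₊, (1 - sectionDensity Ψ i p) ≤
        2 / ((1 - 1 / Real.log (Real.log N) ^ Bη) * Real.log N) * sectionH Ψ i *
          (1 + C / Real.log N)) ∧
      (∀ z : ℝ, 2 ≤ z → z ≤ N →
        ∏ p ∈ Nat.primesBelow ⌈z⌉₊, (1 - sectionDensity Ψ i p) ≤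
          C * Real.log (Real.log N) / Real.log z)

/-- **Elementary preparations for the `u = 2` rung** (`PrLawTwoPrep`; type of `stub_prLawTwoPrep`):
(a) DEGENERATE CASES — for `N ≥ N₀(t, L, u)`, if the section density has a degenerate prime (`g(p) = 1`:
then `ν_p(Ψ) = p` with `p ≤ max(t+1, L) < N^{1/u}`) or the frozen sub-system is locally obstructed
(`𝔖(Ψ₋ᵢ) = 0`), then every joint cell at the coordinate `i` is empty and the model factor
`H_{Ψ,i} · F⁽ⁱ⁾_{j'}` vanishes; (b) the prime-cell model density from below with a rate,
`a_1 ≥ 1/log N - C/log² N` at `u = 2` (Alladi); (c) cells lie in the section support and the section support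
in the rough tuples of `Ψ₋ᵢ` (so `uniformRoughTupleBound` prices `F⁽ⁱ⁾_{j'}`), once `N^{1/u} ≥ 2`;
(d) values of the forms on the box are `≤ 2LN`; (e) the divisor-sequence remainders re-index injectively
into the atom's squarefree moduli: for non-negative `F`, primes `p ≥ z` in a finset `P` and `p·d ≤ M` on
`P × {d < Y : d ∣ P(z)}`, `∑_{p ∈ P} ∑_{d < Y, d ∣ P(z)} F(pd) ≤ ∑_{m ≤ M squarefree} F(m)`. -/
def PrLawTwoPrep : Prop :=
  (∀ (t L u : ℕ), 2 ≤ u → ∃ N₀ : ℕ, ∀ N : ℕ, N₀ ≤ N →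
      ∀ Ψ : Fin (t + 1) → AffLinForm 1, IsNondegenerateSystem Ψ → affLinSize Ψ N ≤ L →
      ∀ (K : Set (Fin 1 → ℝ)) (i : Fin (t + 1)) (j' : Fin t → ℕ),
        ((∃ p : ℕ, p.Prime ∧ sectionDensity Ψ i p = 1) ∨ singularProduct (Fin.removeNth i Ψ) = 0) →
          (∀ m : ℕ, cell Ψ K N u (i.insertNth m j') = 0) ∧
            sectionH Ψ i * (sectionMass Ψ K N u i j' 1 : ℝ) = 0) ∧
  (∃ C : ℝ, 0 ≤ C ∧ ∀ N : ℕ, 3 ≤ N → 1 / Real.log N - C / Real.log N ^ 2 ≤ modelDensity N 2 1) ∧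
  (∀ (t : ℕ) (Ψ : Fin (t + 1) → AffLinForm 1) (K : Set (Fin 1 → ℝ)) (N u : ℕ) (i : Fin (t + 1))
      (j' : Fin t → ℕ), (2 : ℝ) ≤ (N : ℝ) ^ ((1 : ℝ) / u) →
      (∀ m : ℕ, cell Ψ K N u (i.insertNth m j') ≤ sectionMass Ψ K N u i j' 1) ∧
        sectionMass Ψ K N u i j' 1 ≤
          ((latticeBox 1 N).filter fun n =>
            ∀ k : Fin t, (N : ℝ) ^ ((1 : ℝ) / u) <
              (Nat.minFac ((Fin.removeNth i Ψ k).eval n).toNat : ℝ)).card) ∧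
  (∀ (s : ℕ) (Ψ : Fin s → AffLinForm 1) (N L : ℕ), 0 < N → affLinSize Ψ N ≤ L →
      ∀ (k : Fin s), ∀ n ∈ latticeBox 1 N, (((Ψ k).eval n : ℤ) : ℝ) ≤ 2 * L * N) ∧
  (∀ (F : ℕ → ℝ) (P : Finset ℕ) (z : ℝ) (Y M : ℕ), (∀ m, 0 ≤ F m) →
      (∀ p ∈ P, p.Prime ∧ z ≤ (p : ℝ)) →
      (∀ p ∈ P, ∀ d ∈ (Finset.range Y).filter (· ∣ primesProdBelow z), p * d ≤ M) →
        ∑ p ∈ P, ∑ d ∈ (Finset.range Y).filter (· ∣ primesProdBelow z), F (p * d) ≤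
          ∑ m ∈ (Finset.Icc 1 M).filter Squarefree, F m)

/-- **The top cell at `u = 2`** (`PrLawTwoTopCell`; type of `stub_prLawTwoTopCell`): in the non-degenerate
case (no degenerate prime, no local obstruction of `Ψ₋ᵢ`), for `N ≥ N₀(t, L, B)`, the cell of values
`p₁p₂` (`N^{1/2} < p₁ ≤ p₂`) is within the budget: `C_{(2,j')} ≤ N/(log^{t+1} N (log log N)^B)` — Iwaniec's
linear sieve at `s = 2` (`z = N^{1/8}`, `y = N^{1/4}`) on each divisor sequence `b_p`, `N^{1/2} < p ≤ M`,
the window bound `∑_p g(p) ≤ C/log N` read off `Ω(1, L')`, the crude Mertens bound for `V(N^{1/8})`, the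
rough-tuple bound for the fibre mass, and the atom's remainders re-indexed through `(p, d) ↦ pd`. -/
def PrLawTwoTopCell : Prop :=
  SectionSeqFacts → SectionDimension → SectionMertens → PrLawTwoPrep →
    ∀ t : ℕ, 1 ≤ t → SectionLevelAt t → ∀ (L B : ℕ), ∃ N₀ : ℕ, ∀ N : ℕ, N₀ ≤ N →
      ∀ Ψ : Fin (t + 1) → AffLinForm 1, IsNondegenerateSystem Ψ → affLinSize Ψ N ≤ L →
      ∀ K : Set (Fin 1 → ℝ), Convex ℝ K → K ⊆ realBox 1 N →
      ∀ i : Fin (t + 1), ∀ j' : Fin t → ℕ, (∀ k, 1 ≤ j' k ∧ j' k ≤ 2) →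
        (∀ p : ℕ, p.Prime → sectionDensity Ψ i p < 1) → singularProduct (Fin.removeNth i Ψ) ≠ 0 →
          (cell Ψ K N 2 (i.insertNth 2 j') : ℝ) ≤
            (N : ℝ) / (Real.log N ^ (t + 1) * Real.log (Real.log N) ^ B)

/-- **The prime cell at `u = 2`, upper bound with the sharp constant** (`PrLawTwoMainCell`; type of
`stub_prLawTwoMainCell`): in the non-degenerate case, for `N ≥ N₀(t, L, B)`,
`C_{(1,j')} ≤ 2 · a_1 · H_{Ψ,i} · F⁽ⁱ⁾_{j'} + N/(log^{t+1} N (log log N)^B)` — Iwaniec's linear sieve at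
`s = 2` (`F(2) = e^γ`; `y = N^{1-η}`, `z = y^{1/2}`, `η = (log log N)^{-(B+t+D+2)}`) on the section sequence
with the atom's remainders, the sharp Mertens-side bound `e^γ V(z) ≤ (2/((1-η) log N)) H (1 + C/log N)`,
`a_1 ≥ 1/log N - C/log² N`, `F⁽ⁱ⁾ ≤ C (log log N)^t N/log^t N`, `H ≤ C (log log N)^D`. -/
def PrLawTwoMainCell : Prop :=
  SectionSeqFacts → SectionDimension → SectionMertens → EulerRatioIdentity → PrLawTwoPrep →
    ∀ t : ℕ, 1 ≤ t → SectionLevelAt t → ∀ (L B : ℕ), ∃ N₀ : ℕ, ∀ N : ℕ, N₀ ≤ N →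
      ∀ Ψ : Fin (t + 1) → AffLinForm 1, IsNondegenerateSystem Ψ → affLinSize Ψ N ≤ L →
      ∀ K : Set (Fin 1 → ℝ), Convex ℝ K → K ⊆ realBox 1 N →
      ∀ i : Fin (t + 1), ∀ j' : Fin t → ℕ, (∀ k, 1 ≤ j' k ∧ j' k ≤ 2) →
        (∀ p : ℕ, p.Prime → sectionDensity Ψ i p < 1) → singularProduct (Fin.removeNth i Ψ) ≠ 0 →
          (cell Ψ K N 2 (i.insertNth 1 j') : ℝ) ≤
            2 * modelDensity N 2 1 * sectionH Ψ i * (sectionMass Ψ K N 2 i j' 1 : ℝ) +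
              (N : ℝ) / (Real.log N ^ (t + 1) * Real.log (Real.log N) ^ B)

/-- **The `u = 2` rung, assembled** (`PrLawTwoAssembly`; type of `stub_prLawTwoAssembly`): the Euler-ratio
identity, the preparations, the top-cell bound and the sharp prime-cell bound give the `P_r` law at `u = 2`
— in the non-degenerate case take `δ = 2 - C_{(1,j')}/(a_1 H F)` (clipped to `[0, 2]`; the top model
density `a_2` vanishes), otherwise every cell and the model factor vanish. -/
def PrLawTwoAssembly : Prop :=
  SectionSeqFacts → SectionDimension → SectionMertens → EulerRatioIdentity → PrLawTwoPrep →
    PrLawTwoTopCell → PrLawTwoMainCell →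
      ∀ t : ℕ, 1 ≤ t → SectionLevelAt t → SectionPrLawAtU 2 t

end Summit.Parity.GeneralizedHardyLittlewood.Cruxes.CellParityLaw.SectionAnnihilator

end
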